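import Literature.NumberTheory.Automorphic.IdeleNormTowerProofs
import Literature.NumberTheory.GaloisRepresentations.HeckeCharacterInfinityTypeBaseChangeProofs
import Literature.NumberTheory.EllipticCurves.Hsieh2012.NonvanishingHeckeLValuesModP
import HarnessLib

/-!
# Base change of Hecke characters commutes with Galois conjugation; self-duality is inherited
# (Cassels–Fröhlich VII §1–§2: `N_{L/K'}(τ y) = τ|_{K'} N_{L/K'}(y)`; Hsieh 2012 / CHT: `χ^c`, `ψ ∘ N`)

Topic `NumberTheory/GaloisRepresentations`; PROOFS ONLY (no definition, no named fact, no
`sorry`). Requested by route `BiquadraticEisensteinDescent` of `Summits/BirchSwinnertonDyer` (crux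
`EisensteinHeartFlatCMInertBadKPrime`): the binder `Hsieh2012.IsSelfDual` of the anticyclotomic
non-vanishing facts (`Hsieh2012.thmA/rem69`, `HeWei2025.thm14`) at the BED character
`Ψ = ψ_W ∘ N_{L/K_CM}` on the biquadratic CM field `L ⊇ K_CM`.

For a tower of number fields `K ⊆ K' ⊆ L` with `K'|K` and `L|K'` Galois, an automorphism
`τ ∈ Gal(L/K)` with restriction `τ|_{K'} ∈ Gal(K'/K)` (Mathlib `AlgEquiv.restrictNormal`):

* §1 `Automorphic.AdeleRing.ideleRelNorm_smul_tower` — **`N_{L/K'}(τ • y) = τ|_{K'} • N_{L/K'}(y)`**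
  on ideles: `(τ|_{K'} • N y)_L = τ • (N y)_L = τ • ∏_{a ∈ G(L|K')} a • y = ∏_a (τ a τ⁻¹) • (τ • y)`
  and conjugation by `τ` permutes the normal subgroup `G(L|K')` (the tree's
  `smul_ideleBaseChange_tower`, `ideleRelNorm_eq_iff`, `exists_restrictScalars_eq_of_restrictNormal_eq_one`).
* §2 `HeckeCharacter.galConj_compRelNorm` — **`(ω ∘ N_{L/K'}) ∘ τ = (ω ∘ τ|_{K'}) ∘ N_{L/K'}`**
  (`galConj τ (ω.compRelNorm L) = (galConj (τ.restrictNormal K') ω).compRelNorm L`); the action of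
  an automorphism on ideles does not depend on the base field over which it is viewed
  (`galConj_restrictScalars`).
* §3 CM fields `K' ⊆ L` (both CM, `L|K'` Galois, `L|ℚ` and `K'|ℚ` Galois): complex conjugation of
  `L` restricts to that of `K'` (`IsCMField.algebraMap_complexConj`,
  `IsCMField.restrictNormal_complexConj`), hence **self-duality is inherited by base change**:
  `Hsieh2012.IsSelfDual ψ → Hsieh2012.IsSelfDual (ψ.compRelNorm L)`
  (`ψ·(ψ∘c_{K'}) = ‖·‖_{K'}` ⟹ `Ψ·(Ψ∘c_L) = (ψ·(ψ∘c_{K'}))∘N = ‖·‖_{K'}∘N = ‖·‖_L`, with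
  `compRelNorm_mul` and `normCharacter_compRelNorm`).

References: [CasselsFrohlichANT1967] Ch. VII (Tate) §1.1–§2 (action of `G` on `J_L`, the norm);
[Hsieh2012] p. 2 (self-dual characters `χ|_{𝔸_F^×} = τ_{K/F}|·|`); [CHT2008] Lemma 4.1.4 (`χ^c`,
`ψ ∘ N_{F/F⁺}`).
-/

noncomputable section

open scoped NumberField Pointwise
open NumberField IsDedekindDomain

/-! ### §1. The idelic norm and an automorphism of the top field -/

namespace Literature.NumberTheory.Automorphic

variable {K K' L : Type} [Field K] [Field K'] [Field L] [NumberField K] [NumberField K'] [NumberField L]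
  [Algebra K K'] [Algebra K' L] [Algebra K L] [IsScalarTower K K' L]
  [IsGalois K K'] [IsGalois K' L]

omit [NumberField K] [NumberField K'] [NumberField L] [IsGalois K' L] in
/-- Conjugation by `τ ∈ G(L|K)` preserves `G(L|K')` (a normal subgroup, `K'|K` being normal): for
`a ∈ G(L|K')` there is `a' ∈ G(L|K')` with `a' = τ a τ⁻¹` as `K`-automorphisms.
[cite: CasselsFrohlichANT1967, Ch. VII §1.1] -/
theorem exists_restrictScalars_eq_conj (τ : L ≃ₐ[K] L) (a : L ≃ₐ[K'] L) :
    ∃ a' : L ≃ₐ[K'] L, a'.restrictScalars K = τ * a.restrictScalars K * τ⁻¹ := by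
  refine exists_restrictScalars_eq_of_restrictNormal_eq_one (K := K) (K' := K') (L := L) ?_
  have hres : (a.restrictScalars K).restrictNormal K' = 1 := by
    refine AlgEquiv.ext fun c => (algebraMap K' L).injective ?_
    rw [AlgEquiv.restrictNormal_commutes, AlgEquiv.one_apply]
    exact a.commutes c
  change AlgEquiv.restrictNormalHom K' (τ * a.restrictScalars K * τ⁻¹) = 1
  rw [map_mul, map_mul, map_inv]
  change τ.restrictNormal K' * (a.restrictScalars K).restrictNormal K' * (τ.restrictNormal K')⁻¹ = 1
  rw [hres, mul_one, mul_inv_cancel]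

omit [NumberField K] in
/-- **`N_{L/K'}(τ • y) = τ|_{K'} • N_{L/K'}(y)`** for `τ ∈ G(L|K)` and an idele `y` of `L`: the
idelic norm of a Galois tower intertwines the action of `G(L|K)` on `𝕀_L` with that of `G(K'|K)`
on `𝕀_{K'}` through restriction (`(σ x)_{σw} = σ_w x_w`, Tate VII §1.1, and `N = ∏_{a∈G(L|K')} a`).
[cite: CasselsFrohlichANT1967, Ch. VII §1.1–§2] -/
theorem AdeleRing.ideleRelNorm_smul_tower (τ : L ≃ₐ[K] L) (y : (AdeleRing (𝓞 L) L)ˣ) :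
    AdeleRing.ideleRelNorm K' L (τ • y) =
      τ.restrictNormal K' • AdeleRing.ideleRelNorm K' L y := by
  classical
  refine (AdeleRing.ideleRelNorm_eq_iff (F := K') (E := L)).2 ?_
  rw [← AdeleRing.smul_ideleBaseChange_tower, AdeleRing.ideleBaseChange_ideleRelNorm,
    AdeleRing.ideleGalNorm_apply, AdeleRing.ideleGalNorm_apply, Finset.smul_prod']
  -- `τ • (a • y) = (τ a τ⁻¹) • (τ • y)`; reindex along conjugation by `τ`
  choose f hf using exists_restrictScalars_eq_conj (K := K) (K' := K') (L := L) τ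
  have hf_inj : Function.Injective f := fun a b h ↦ by
    have h' : τ * a.restrictScalars K * τ⁻¹ = τ * b.restrictScalars K * τ⁻¹ := by rw [← hf, ← hf, h]
    exact AlgEquiv.restrictScalars_injective K (mul_right_cancel (mul_left_cancel h'))
  have hf_bij : Function.Bijective f := (Finite.injective_iff_bijective).mp hf_inj
  refine Fintype.prod_equiv (Equiv.ofBijective f hf_bij) (fun a ↦ τ • (a • y))
    (fun a ↦ a • (τ • y)) fun a ↦ ?_
  -- `τ • (a • y) = f a • (τ • y)` since `f a = τ a τ⁻¹`
  change τ • (a.restrictScalars K • y) = (f a).restrictScalars K • (τ • y)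
  rw [← mul_smul, ← mul_smul, hf, inv_mul_cancel_right]

end Literature.NumberTheory.Automorphic

/-! ### §2. Base change of Hecke characters and Galois conjugation -/

namespace Literature.NumberTheory.GaloisRepresentations

section GalConj

variable {K K' L : Type} [Field K] [Field K'] [Field L] [NumberField K] [NumberField K'] [NumberField L]
  [Algebra K K'] [Algebra K' L] [Algebra K L] [IsScalarTower K K' L]

omit [NumberField K] [NumberField K'] in
/-- The conjugate `χ ∘ a` by an automorphism `a` of `L` does not depend on the base field over which
`a` is viewed (`a` acts on the ideles through its underlying ring automorphism).
[cite: CasselsFrohlichANT1967, Ch. VII §1.1] -/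
theorem HeckeCharacter.galConj_restrictScalars (a : L ≃ₐ[K'] L) (χ : HeckeCharacter L) :
    HeckeCharacter.galConj (a.restrictScalars K) χ = HeckeCharacter.galConj a χ :=
  HeckeCharacter.ext fun _ ↦ rfl

variable [IsGalois K K'] [IsGalois K' L]

omit [NumberField K] in
/-- **`(ω ∘ N_{L/K'}) ∘ τ = (ω ∘ τ|_{K'}) ∘ N_{L/K'}`**: base change commutes with Galois
conjugation — `galConj τ (ω.compRelNorm L) = (galConj (τ|_{K'}) ω).compRelNorm L` for
`τ ∈ G(L|K)` (from `N_{L/K'}(τ • y) = τ|_{K'} • N_{L/K'} y`). CHT's `(ψ ∘ N_{F/F⁺})^c`.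
[cite: CasselsFrohlichANT1967, Ch. VII §2 and Prop. 4.3] -/
theorem HeckeCharacter.galConj_compRelNorm (τ : L ≃ₐ[K] L) (ω : HeckeCharacter K') :
    HeckeCharacter.galConj τ (ω.compRelNorm L) =
      (HeckeCharacter.galConj (τ.restrictNormal K') ω).compRelNorm L :=
  HeckeCharacter.ext fun y ↦ by
    rw [HeckeCharacter.galConj_apply, HeckeCharacter.compRelNorm_apply,
      HeckeCharacter.compRelNorm_apply, HeckeCharacter.galConj_apply,
      Automorphic.AdeleRing.ideleRelNorm_smul_tower]

end GalConj

/-! ### §3. CM fields: complex conjugation restricts, self-duality is inherited -/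

section CM

variable {K' L : Type} [Field K'] [Field L] [NumberField K'] [NumberField L] [Algebra K' L]
  [IsCMField K'] [IsCMField L]

/-- **Complex conjugation of a CM field restricts to complex conjugation of a CM subfield**:
`c_L(x) = c_{K'}(x)` for `x ∈ K' ⊆ L` (read both through one complex embedding of `L`, Mathlib
`IsCMField.complexEmbedding_complexConj`). [cite: Hsieh2012, p. 2 (the CM field `K`, `c`)] -/
theorem IsCMField.algebraMap_complexConj (x : K') :
    algebraMap K' L (IsCMField.complexConj K' x) = IsCMField.complexConj L (algebraMap K' L x) := by
  let φ : L →+* ℂ := Classical.choice inferInstance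
  apply φ.injective
  rw [IsCMField.complexEmbedding_complexConj L φ, ← RingHom.comp_apply, ← RingHom.comp_apply,
    IsCMField.complexEmbedding_complexConj K' (φ.comp (algebraMap K' L))]
  rfl

variable [IsGalois ℚ K'] [IsGalois ℚ L]

/-- The restriction of `c_L` (viewed over `ℚ`) to the normal subfield `K'` is `c_{K'}`.
[cite: Hsieh2012, p. 2 (the CM field `K`, `c`)] -/
theorem IsCMField.restrictNormal_complexConj :
    ((IsCMField.complexConj L).restrictScalars ℚ).restrictNormal K' =
      (IsCMField.complexConj K').restrictScalars ℚ := by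
  refine AlgEquiv.ext fun x ↦ (algebraMap K' L).injective ?_
  rw [AlgEquiv.restrictNormal_commutes, AlgEquiv.restrictScalars_apply,
    AlgEquiv.restrictScalars_apply, IsCMField.algebraMap_complexConj]

variable [IsGalois K' L]

/-- **`(ψ ∘ N_{L/K'}) ∘ c_L = (ψ ∘ c_{K'}) ∘ N_{L/K'}`** for CM fields `K' ⊆ L`.
[cite: Hsieh2012, p. 2] [cite: CasselsFrohlichANT1967, Ch. VII §2] -/
theorem HeckeCharacter.galConj_complexConj_compRelNorm (ψ : HeckeCharacter K') :
    HeckeCharacter.galConj (IsCMField.complexConj L) (ψ.compRelNorm L) =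
      (HeckeCharacter.galConj (IsCMField.complexConj K') ψ).compRelNorm L := by
  rw [← HeckeCharacter.galConj_restrictScalars (K := ℚ) (IsCMField.complexConj L),
    HeckeCharacter.galConj_compRelNorm, IsCMField.restrictNormal_complexConj,
    HeckeCharacter.galConj_restrictScalars]

/-- **Self-duality is inherited by base change between CM fields**: if `ψ·(ψ ∘ c_{K'}) = ‖·‖_{K'}`
(`Hsieh2012.IsSelfDual ψ`, "`ψ|_{𝔸_F^×} = τ|·|`") then `Ψ = ψ ∘ N_{L/K'}` satisfies
`Ψ·(Ψ ∘ c_L) = ‖·‖_L` — the `IsSelfDual` binder of the anticyclotomic non-vanishing facts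
(`Hsieh2012.thmA/rem69_NV_of_isSelfDual`, `HeWei2025.thm14_NVInfinite_of_isSelfDual`) at a
base-changed character (BSD: `Ψ = ψ_W ∘ N_{L/K_CM}` on the biquadratic CM field).
[cite: Hsieh2012, p. 2 ("χ is self-dual if χ|_{𝔸_F^×} = τ_{K/F}|·|_{𝔸_F}")] -/
theorem _root_.Literature.NumberTheory.EllipticCurves.Hsieh2012.IsSelfDual.compRelNorm
    {ψ : HeckeCharacter K'} (h : EllipticCurves.Hsieh2012.IsSelfDual ψ) :
    EllipticCurves.Hsieh2012.IsSelfDual (ψ.compRelNorm L) := by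
  unfold EllipticCurves.Hsieh2012.IsSelfDual at h ⊢
  rw [HeckeCharacter.galConj_complexConj_compRelNorm, ← HeckeCharacter.compRelNorm_mul, h,
    HeckeCharacter.normCharacter_compRelNorm]

end CM

end Literature.NumberTheory.GaloisRepresentations

end
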